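import Summits.Ventures.PercRepro.S2SetCount

/-!
# PercRepro — S2: THE LEVEL COUNT INDEXED BY SPANNING SETS, PART B — THE CLASSES AND THE COUNT (p7, gen 3; S2)

The spanning `(q + 1)`-sets of `S2SetCount` split by the size of their closure exactly as p8's pairs do (small:
`≤ f′ + 1` points; mid: `> f′ + 1` and `< q + ν₁`; giant: `≥ q + ν₁` — and the giant closure is the ONE giant flat,
`closure_eq_of_spanGiant`, through `exists_pair_of_mem_spanAll` and p8's `closure_eq_of_giant`). The giant class is
a family of `(q + 1)`-subsets of that flat: **`card_spanGiant_le`** — `#spanGiant ≤ C(min(f, q + d), q + 1)`. Hence the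
PARTITION COUNT (`ncard_eRk_eq_ncard_le_le_sets`, with a size bound `D`):
`#{B ⊆ E : r(B) = q, |B| ≤ D} ≤ C(n, q) + σ_m·Σ_k s_k·C(n − k, q + 1 − k) + (σ_g − σ_m)·C(min(f, q + d), q + 1)`,
`σ_x = Σ_{j ≤ D − q − 1} C(x, j)/(j + 1 + 3·C(j + 1, 2))` over the free points of the class (`f′ − q` small,
`min(f − q − 1, ν₁ − 2)` mid, `min(f, q + d) − q − 1` giant). Axioms: standard.
-/

open scoped Matroid

namespace PercRepro

namespace S2

open Set Finset

variable {α : Type} {M : Matroid α}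

open scoped Classical in
/-- The spanning sets with a small closure (`≤ f′ + 1` points). -/
noncomputable def spanSmall (M : Matroid α) [M.Finite] (q f' : ℕ) : Finset (Set α) :=
  (spanAll M q).filter (fun S => (M.closure S).ncard ≤ f' + 1)

open scoped Classical in
/-- The spanning sets with a big closure (`> f′ + 1` points). -/
noncomputable def spanBig (M : Matroid α) [M.Finite] (q f' : ℕ) : Finset (Set α) :=
  (spanAll M q).filter (fun S => ¬ (M.closure S).ncard ≤ f' + 1)

open scoped Classical in
/-- The GIANT spanning sets: big, with a closure of `≥ q + ν₁` points. -/
noncomputable def spanGiant (M : Matroid α) [M.Finite] (q f' ν₁ : ℕ) : Finset (Set α) :=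
  (spanBig M q f').filter (fun S => q + ν₁ ≤ (M.closure S).ncard)

open scoped Classical in
/-- The MID spanning sets: big, with a closure of `< q + ν₁` points. -/
noncomputable def spanMid (M : Matroid α) [M.Finite] (q f' ν₁ : ℕ) : Finset (Set α) :=
  (spanBig M q f').filter (fun S => ¬ q + ν₁ ≤ (M.closure S).ncard)

/-- The closure of a spanning set has `|cl S ∖ S| = |cl S| − (q + 1)`. -/
theorem ncard_closure_sdiff_of_mem_spanAll [M.Finite] {q : ℕ} {S : Set α} (hS : S ∈ spanAll M q) :
    (M.closure S \ S).ncard = (M.closure S).ncard - (q + 1) := by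
  obtain ⟨hSE, hSc, -⟩ := mem_spanAll.1 hS
  have hSF : S ⊆ M.closure S := M.subset_closure S hSE
  have hFfin : (M.closure S).Finite := M.ground_finite.subset (M.closure_subset_ground _)
  rw [Set.ncard_sdiff' hSF hFfin, hSc]

open scoped Classical in
/-- The fibre bound for a SMALL set: `≤ C(f′ − q, m − q − 1)`. -/
theorem card_fibreS_small [M.Finite] (q f' : ℕ) {S : Set α} (hS : S ∈ spanSmall M q f') (m : ℕ) :
    (fibreS M q S m).card ≤ (f' - q).choose (m - (q + 1)) := by
  unfold spanSmall at hS
  rw [Finset.mem_filter] at hS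
  refine (card_fibreS_le_choose q hS.1 m).trans (Nat.choose_le_choose _ ?_)
  rw [ncard_closure_sdiff_of_mem_spanAll hS.1]
  omega

open scoped Classical in
/-- The fibre bound for a MID set: `≤ C(min(f − (q + 1), ν₁ − 2), m − q − 1)`. -/
theorem card_fibreS_mid [M.Finite] (q f f' ν₁ : ℕ) (hflat : ∀ X ⊆ M.E, M.eRk X ≤ q → X.ncard ≤ f)
    {S : Set α} (hS : S ∈ spanMid M q f' ν₁) (m : ℕ) :
    (fibreS M q S m).card ≤ (min (f - (q + 1)) (ν₁ - 2)).choose (m - (q + 1)) := by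
  unfold spanMid spanBig at hS
  rw [Finset.mem_filter, Finset.mem_filter] at hS
  obtain ⟨⟨hSa, -⟩, hmid⟩ := hS
  push Not at hmid
  have hr := (mem_spanAll.1 hSa).2.2
  have hFf : (M.closure S).ncard ≤ f :=
    hflat _ (M.closure_subset_ground _) (by rw [M.eRk_closure_eq, hr])
  refine (card_fibreS_le_choose q hSa m).trans (Nat.choose_le_choose _ ?_)
  rw [ncard_closure_sdiff_of_mem_spanAll hSa]
  omega

open scoped Classical in
/-- The closure of a spanning set has `≤ min(f, q + d)` points. -/
theorem ncard_closure_le_of_mem_spanAll [M.Finite] (q f : ℕ) (hflat : ∀ X ⊆ M.E, M.eRk X ≤ q → X.ncard ≤ f)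
    {d : ℕ} (hd : M.E.encard = M.eRank + d) {S : Set α} (hS : S ∈ spanAll M q) :
    (M.closure S).ncard ≤ min f (q + d) := by
  have hr := (mem_spanAll.1 hS).2.2
  set F := M.closure S with hF
  have hFE : F ⊆ M.E := M.closure_subset_ground _
  have hFfin : F.Finite := M.ground_finite.subset hFE
  have hFf : F.ncard ≤ f := hflat F hFE (by rw [hF, M.eRk_closure_eq, hr])
  have hFd : F.ncard ≤ q + d := by
    have hcap := Matroid.encard_le_eRk_add_of_encard_eq (M := M) hFE hd
    rw [hF, M.eRk_closure_eq, hr, ← hFfin.cast_ncard_eq] at hcap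
    exact_mod_cast hcap
  exact le_min hFf hFd

open scoped Classical in
/-- The fibre bound for a GIANT set: `≤ C(min(f, q + d) − (q + 1), m − q − 1)`. -/
theorem card_fibreS_giant [M.Finite] (q f f' ν₁ : ℕ) (hflat : ∀ X ⊆ M.E, M.eRk X ≤ q → X.ncard ≤ f)
    {d : ℕ} (hd : M.E.encard = M.eRank + d) {S : Set α} (hS : S ∈ spanGiant M q f' ν₁) (m : ℕ) :
    (fibreS M q S m).card ≤ (min f (q + d) - (q + 1)).choose (m - (q + 1)) := by
  have hSa : S ∈ spanAll M q := (Finset.mem_filter.1 (Finset.mem_filter.1 hS).1).1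
  refine (card_fibreS_le_choose q hSa m).trans (Nat.choose_le_choose _ ?_)
  rw [ncard_closure_sdiff_of_mem_spanAll hSa]
  have := ncard_closure_le_of_mem_spanAll q f hflat hd hSa
  omega

open scoped Classical in
/-- **The giant flat is unique (sets)**: two giant spanning sets have the same closure. -/
theorem closure_eq_of_spanGiant [M.Finite] {q f' ν₁ νi : ℕ} (hq : 1 ≤ q)
    (hcirc : ∀ C, M.IsCircuit C → 3 ≤ C.encard)
    (hflat' : ∀ X ⊆ M.E, M.eRk X ≤ (q - 1 : ℕ) → X.ncard ≤ f')
    (hinter : ∀ X ⊆ M.E, M.eRk X ≤ (q - 1 : ℕ) → (X.ncard : ℕ∞) ≤ M.eRk X + νi)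
    {d : ℕ} (hd : M.E.encard = M.eRank + d) (h2 : d + νi < 2 * ν₁)
    {S₁ S₂ : Set α} (h₁ : S₁ ∈ spanGiant M q f' ν₁) (h₂ : S₂ ∈ spanGiant M q f' ν₁) :
    M.closure S₁ = M.closure S₂ := by
  have key : ∀ {S : Set α}, S ∈ spanGiant M q f' ν₁ →
      ∃ p ∈ Matroid.pairsGiant M q f' ν₁, p.1 ∪ p.2 = S := by
    intro S hS
    unfold spanGiant spanBig at hS
    rw [Finset.mem_filter, Finset.mem_filter] at hS
    obtain ⟨⟨hSa, hbig⟩, hgiant⟩ := hS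
    obtain ⟨p, hp, hpS⟩ := exists_pair_of_mem_spanAll q hcirc hSa
    refine ⟨p, ?_, hpS⟩
    unfold Matroid.pairsGiant Matroid.pairsBig
    rw [Finset.mem_filter, Finset.mem_filter, hpS]
    exact ⟨⟨hp, hbig⟩, hgiant⟩
  obtain ⟨p₁, hp₁, rfl⟩ := key h₁
  obtain ⟨p₂, hp₂, rfl⟩ := key h₂
  exact Matroid.closure_eq_of_giant hq hflat' hinter hd h2 hp₁ hp₂

open scoped Classical in
/-- **The giant class is a family of `(q + 1)`-subsets of the one giant flat**: `#spanGiant ≤ C(min(f, q + d), q + 1)`. -/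
theorem card_spanGiant_le [M.Finite] {q f f' ν₁ νi : ℕ} (hq : 1 ≤ q)
    (hcirc : ∀ C, M.IsCircuit C → 3 ≤ C.encard)
    (hflat : ∀ X ⊆ M.E, M.eRk X ≤ q → X.ncard ≤ f)
    (hflat' : ∀ X ⊆ M.E, M.eRk X ≤ (q - 1 : ℕ) → X.ncard ≤ f')
    (hinter : ∀ X ⊆ M.E, M.eRk X ≤ (q - 1 : ℕ) → (X.ncard : ℕ∞) ≤ M.eRk X + νi)
    {d : ℕ} (hd : M.E.encard = M.eRank + d) (h2 : d + νi < 2 * ν₁) :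
    (spanGiant M q f' ν₁).card ≤ (min f (q + d)).choose (q + 1) := by
  rcases (spanGiant M q f' ν₁).eq_empty_or_nonempty with hemp | ⟨S₀, hS₀⟩
  · rw [hemp, Finset.card_empty]; exact Nat.zero_le _
  have hS₀a : S₀ ∈ spanAll M q := (Finset.mem_filter.1 (Finset.mem_filter.1 hS₀).1).1
  set F := M.closure S₀ with hF
  have hFE : F ⊆ M.E := M.closure_subset_ground _
  have hFfin : F.Finite := M.ground_finite.subset hFE
  set Ff := hFfin.toFinset with hFf
  have hFcard : Ff.card ≤ min f (q + d) := by
    rw [hFf, ← Set.ncard_eq_toFinset_card _ hFfin]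
    exact ncard_closure_le_of_mem_spanAll q f hflat hd hS₀a
  have hsub : spanGiant M q f' ν₁ ⊆ Matroid.subsF Ff (q + 1) := by
    intro S hS
    have hSa : S ∈ spanAll M q := (Finset.mem_filter.1 (Finset.mem_filter.1 hS).1).1
    obtain ⟨hSE, hSc, -⟩ := mem_spanAll.1 hSa
    have hcl : M.closure S = F := closure_eq_of_spanGiant hq hcirc hflat' hinter hd h2 hS hS₀
    apply Matroid.mem_subsF_of _ hSc
    rw [hFf, Set.Finite.coe_toFinset, ← hcl]
    exact M.subset_closure S hSE
  calc (spanGiant M q f' ν₁).card ≤ (Matroid.subsF Ff (q + 1)).card := Finset.card_le_card hsub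
    _ ≤ Ff.card.choose (q + 1) := Matroid.card_subsF_le _ _
    _ ≤ _ := Nat.choose_le_choose _ hFcard

open scoped Classical in
/-- **The level-`m` count over the three classes**:
`μ(m − q)·#levelF ≤ #small·C(f′ − q, ·) + #mid·C(min(f − q − 1, ν₁ − 2), ·) + #giant·C(min(f, q + d) − q − 1, ·)`. -/
theorem mul_card_levelF_le_classes [M.Finite] (q f f' ν₁ : ℕ) (hq : 1 ≤ q)
    (hcirc : ∀ C, M.IsCircuit C → 3 ≤ C.encard) (hC1 : ∀ L ⊆ M.E, M.eRk L = 2 → L.ncard ≤ 3)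
    (hflat : ∀ X ⊆ M.E, M.eRk X ≤ q → X.ncard ≤ f) {d : ℕ} (hd : M.E.encard = M.eRank + d) (m : ℕ) :
    ((m - q) + 3 * (m - q).choose 2) * (Matroid.levelF M q m).card ≤
      (spanSmall M q f').card * (f' - q).choose (m - (q + 1)) +
        (spanMid M q f' ν₁).card * (min (f - (q + 1)) (ν₁ - 2)).choose (m - (q + 1)) +
        (spanGiant M q f' ν₁).card * (min f (q + d) - (q + 1)).choose (m - (q + 1)) := by
  have hsplit : ∑ S ∈ spanAll M q, (fibreS M q S m).card =
      ∑ S ∈ spanSmall M q f', (fibreS M q S m).card +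
        (∑ S ∈ spanMid M q f' ν₁, (fibreS M q S m).card + ∑ S ∈ spanGiant M q f' ν₁, (fibreS M q S m).card) := by
    unfold spanSmall spanMid spanGiant spanBig
    rw [← Finset.sum_filter_add_sum_filter_not (spanAll M q) (fun S => (M.closure S).ncard ≤ f' + 1)]
    congr 1
    rw [← Finset.sum_filter_add_sum_filter_not ((spanAll M q).filter (fun S => ¬ (M.closure S).ncard ≤ f' + 1))
      (fun S => q + ν₁ ≤ (M.closure S).ncard), add_comm]
  refine (mul_card_levelF_le_sum_spanAll q hq hcirc hC1 m).trans ?_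
  rw [hsplit, ← add_assoc]
  have h1 : ∑ S ∈ spanSmall M q f', (fibreS M q S m).card ≤
      (spanSmall M q f').card * (f' - q).choose (m - (q + 1)) := by
    rw [Finset.card_eq_sum_ones, Finset.sum_mul]
    exact Finset.sum_le_sum (fun S hS => by rw [one_mul]; exact card_fibreS_small q f' hS m)
  have h2 : ∑ S ∈ spanMid M q f' ν₁, (fibreS M q S m).card ≤
      (spanMid M q f' ν₁).card * (min (f - (q + 1)) (ν₁ - 2)).choose (m - (q + 1)) := by
    rw [Finset.card_eq_sum_ones, Finset.sum_mul]
    exact Finset.sum_le_sum (fun S hS => by rw [one_mul]; exact card_fibreS_mid q f f' ν₁ hflat hS m)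
  have h3 : ∑ S ∈ spanGiant M q f' ν₁, (fibreS M q S m).card ≤
      (spanGiant M q f' ν₁).card * (min f (q + d) - (q + 1)).choose (m - (q + 1)) := by
    rw [Finset.card_eq_sum_ones, Finset.sum_mul]
    exact Finset.sum_le_sum (fun S hS => by rw [one_mul]; exact card_fibreS_giant q f f' ν₁ hflat hd hS m)
  omega

end S2

end PercRepro
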